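import Summits.ResolutionOfSingularities.ResolutionOfSingularities.Theorems.FrobeniusLadderFInjectiveMacaulayficationReductions
import Literature.AlgebraicGeometry.Resolution.Macaulayfication
import Literature.AlgebraicGeometry.Resolution.Blowups
import Literature.AlgebraicGeometry.Resolution.BlowupsExistence
import Literature.AlgebraicGeometry.Resolution.BlowupsIntegral
import Literature.AlgebraicGeometry.Resolution.BlowupsProperProofs

/-!
# Line `isolation` — crux `FInjectiveMacaulayfication` (route `ResolutionOfSingularities/FrobeniusLadder`, rung 2)
## crux-strategist, BC2 REDIRECT (2026-08-17): the ISOLATION SPLIT as a registered skeleton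

The crux (every reduced separated finite-type `X/k`, `char k = p`, has a proper birational model whose stalks are
Cohen–Macaulay F-injective domains — inline clause) DECOMPOSES along the fault line its own evidence exhibits (point
centres F-injectivize ISOLATED bad germs — `E8Char5FiModel` p139106, the char-3 tower `E7Char3FiModel` p145076, the
threefold item `ThreefoldFInjectiveBlowup` stmt-17936 — but die once the bad locus is a CURVE, survey j023222):

  FInjectiveMacaulayfication ⇐ FInjectiveIsolation ∧ IsolatedFInjectivization  (assembly: `IsolationSplit.lean`; here inlined in `FInjectiveMacaulayfication_proof`)

* PIECE ISO `FInjectiveIsolation` ("F-injective Macaulayfication away from finitely many points"): every INTEGRAL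
  separated finite-type `X/k` has a proper birational INTEGRAL model `X₁` with Cohen–Macaulay local rings and only
  FINITELY MANY points carrying a non-Frobenius-closed parameter ideal. Sub-skeleton (§1): `stub_kawasakiIntegral`
  (Kawasaki/Česnavičius, in print; shared with line `Sketch`), `stub_fiLocusOpen` (Datta–Murayama arXiv:1906.11399 Thm B +
  Quy–Shimomoto arXiv:1601.02524: the F-injective locus is open), `stub_genericFInjectivization` (OPEN: F-injectivize in
  codimension `< dim` keeping Cohen–Macaulay), `stub_closedPointsOfClosedFinite` (folklore count) ⟹
  `fInjectiveIsolation_of_stubs`.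
* PIECE PT `IsolatedFInjectivization` ("isolated non-F-injective points can be F-injectivized"): an integral
  Cohen–Macaulay `X₁/k` with finitely many bad points has a model with the full clause everywhere. Sub-skeleton (§2):
  `stub_badPointsClosed` (E5 generization, landed, + Jacobson), `stub_pointCentreExists` (OPEN LOCAL CORE: a centre
  supported AT the bad point whose blow-up is good over it — the shape of every landed calibration and of
  `Sketch.stub_fiModelOfPointSupportedCentre`), `stub_surgeryGlue` (folklore: blow up `⨅ J b`, blow-ups are local,
  `IsBlowup.restrict/unique/isIso_compl/isProper/isBirational'`) ⟹ `isolatedFInjectivization_of_stubs`.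
* ASSEMBLY (§3, inlined in `FInjectiveMacaulayfication_proof`; stand-alone binder form = crux workfile `IsolationSplit.lean`
  = the candidate Theorems file `FrobeniusLadderFInjectiveMacaulayficationSplit.lean`): `fInjectiveMacaulayfication_iff_integral.mpr`; ISO model
  `π₁ : X₁ → X`; PT over `π₁ ≫ f`; compose (proper ∘ proper, `ComponentGluing.IsBirational.comp`,
  `isIntegral_of_isBirational_of_isDomain_stalk`). Registered composition `FInjectiveMacaulayfication_proof` (§3): the seven
  stubs ⟹ the crux BY NAME.

BC2 (c): the per-piece probes `ISO → S`, `ISO → crux`, `PT → S`, `PT → crux` all FAIL under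
`first | exact? | simpa [C] | (unfold C; simpa) | aesop` (folder bc/*_probe.lean, rc 1 ×2); `#h21_crux_probe` CLEAN for
both pieces; each piece is a consequence of the crux (`Split.isolation_of_fInjectiveMacaulayfication`,
`Split.isolated_of_fInjectiveMacaulayfication`), neither is known to give it back. The two pieces were filed for
`route edit --split FInjectiveMacaulayfication --into children.json` (refused for this seat: "final cycle only";
command + children.json attached as evidence on the crux item).

WHY IT DODGES THE STUCK GOAL of line `Sketch` (`stub_fInjectivizeIntegral` = the crux modulo Kawasaki, one hole): the
hole is cut in two non-equivalent holes with different owners — the ISOLATED hole (§2) is where the point-centre/tower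
engine and all certificates (E1–E7) already apply and a measure (HSL number / Fedder datum per tower) can be sought one
point at a time; the GENERIC hole (§1) is a codimension climb (surface crux over imperfect function fields, spread out)
that never needs to terminate a point tower. Disproof.lean honoured: no parameter centre (§3 there; p129572/p129192), the
modification changes the bad points and is not finite, `IsReduced` enters through integrality (`iff_integral`,
`IsBlowup.isIntegral`), `p.Prime` rides along; no stub is an instance a landed Negative lemma refutes.
-/

-- single-problem summit: the doubled namespace component is forced
set_option linter.dupNamespace false

noncomputable section

open AlgebraicGeometry CategoryTheory Literature.AlgebraicGeometry.Resolution
open Summit.ResolutionOfSingularities.ResolutionOfSingularities.Theorems.FInjectiveMacaulayfication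

namespace Summit.ResolutionOfSingularities.ResolutionOfSingularities.Cruxes.FInjectiveMacaulayfication.Isolation

/-! ## §1 Piece ISO — isolation of the bad locus (4 stubs + composition) -/

/-- THE RUNG BELOW, INTEGRAL FORM (Kawasaki 2000, Trans. AMS 352, Thm 1.1; Česnavičius arXiv:1810.04493 Thm 1.6 —
Macaulayfication; = `Literature.AlgebraicGeometry.Resolution.KawasakiMacaulayfication.{0}` unfolded; shared verbatim with
line `Sketch` of crux `FInjectiveMacaulayfication`): every integral separated finite-type `X/k` has a proper birational
model `X₁ → X` with `X₁` integral and all local rings Cohen–Macaulay. [cite: Kawasaki2000, Thm 1.1] -/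
theorem stub_kawasakiIntegral : ∀ (k : Type) [Field k] (X : Scheme.{0}) (f : X ⟶ Spec (.of k)),
    IsSeparated f → LocallyOfFiniteType f → QuasiCompact f → IsIntegral X →
      ∃ (X₁ : Scheme.{0}) (π₁ : X₁ ⟶ X), IsProper π₁ ∧
        Literature.AlgebraicGeometry.Resolution.IsBirational π₁ ∧ IsIntegral X₁ ∧
        ∀ x : X₁, ∀ d : ℕ, ringKrullDim (X₁.presheaf.stalk x) = d →
          ∀ s : Fin d → X₁.presheaf.stalk x, (Ideal.span (Set.range s)).radical.IsMaximal →
            RingTheory.Sequence.IsWeaklyRegular (X₁.presheaf.stalk x) (List.ofFn s) := by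
  sorry

/-- OPENNESS OF THE F-INJECTIVE LOCUS on a scheme locally of finite type over a field of characteristic `p` whose local
rings are Cohen–Macaulay: the set of points at which every parameter ideal is Frobenius closed is open
(Datta–Murayama arXiv:1906.11399 Thm B — openness of the F-injective locus for rings essentially of finite type over an
excellent local ring; Fedder–Watanabe / Quy–Shimomoto arXiv:1601.02524 — for a Cohen–Macaulay local ring, F-injective ⇔
every ideal generated by a system of parameters is Frobenius closed; openness is local, so the affine case suffices).
[cite: arXiv:1906.11399, Thm B] -/
theorem stub_fiLocusOpen : ∀ (p : ℕ), p.Prime → ∀ (k : Type) [Field k] [CharP k p] (X₁ : Scheme.{0})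
    (f₁ : X₁ ⟶ Spec (.of k)), LocallyOfFiniteType f₁ →
    (∀ x : X₁, ∀ d : ℕ, ringKrullDim (X₁.presheaf.stalk x) = d →
      ∀ s : Fin d → X₁.presheaf.stalk x, (Ideal.span (Set.range s)).radical.IsMaximal →
        RingTheory.Sequence.IsWeaklyRegular (X₁.presheaf.stalk x) (List.ofFn s)) →
    IsOpen {x : X₁ | ∀ d : ℕ, ringKrullDim (X₁.presheaf.stalk x) = d →
      ∀ s : Fin d → X₁.presheaf.stalk x, (Ideal.span (Set.range s)).radical.IsMaximal →
        ∀ y : X₁.presheaf.stalk x, (∃ e : ℕ, y ^ p ^ e ∈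
          Ideal.span ((fun z : X₁.presheaf.stalk x => z ^ p ^ e) ''
            (Ideal.span (Set.range s) : Set (X₁.presheaf.stalk x)))) → y ∈ Ideal.span (Set.range s)} := by
  sorry

/-- THE OPEN STEP — GENERIC F-INJECTIVIZATION (F-injectivize in codimension `< dim`, keeping Cohen–Macaulay): for
`p` prime, `k` of characteristic `p` and `X₁/k` integral separated of finite type with Cohen–Macaulay local rings,
there is a proper birational `π : X₂ → X₁` with `X₂` integral, all local rings Cohen–Macaulay, and every NON-CLOSED point
of `X₂` having all its parameter ideals Frobenius closed. A consequence of the parent crux (whose model has the clause at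
every point); the content: the surface/lower-dimensional crux over the imperfect function fields of the positive-dimensional
components of the non-F-injective locus, spread out, followed by re-Macaulayfication over finitely many closed points
(Česnavičius 2021 Thm 5.3: a Macaulayfication that is an isomorphism over the Cohen–Macaulay locus). [conjecture] -/
theorem stub_genericFInjectivization : ∀ (p : ℕ), p.Prime → ∀ (k : Type) [Field k] [CharP k p] (X₁ : Scheme.{0})
    (f₁ : X₁ ⟶ Spec (.of k)), IsSeparated f₁ → LocallyOfFiniteType f₁ → QuasiCompact f₁ → IsIntegral X₁ →
    (∀ x : X₁, ∀ d : ℕ, ringKrullDim (X₁.presheaf.stalk x) = d →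
      ∀ s : Fin d → X₁.presheaf.stalk x, (Ideal.span (Set.range s)).radical.IsMaximal →
        RingTheory.Sequence.IsWeaklyRegular (X₁.presheaf.stalk x) (List.ofFn s)) →
    ∃ (X₂ : Scheme.{0}) (π : X₂ ⟶ X₁), IsProper π ∧ Literature.AlgebraicGeometry.Resolution.IsBirational π ∧
      IsIntegral X₂ ∧
      (∀ x : X₂, ∀ d : ℕ, ringKrullDim (X₂.presheaf.stalk x) = d →
        ∀ s : Fin d → X₂.presheaf.stalk x, (Ideal.span (Set.range s)).radical.IsMaximal →
          RingTheory.Sequence.IsWeaklyRegular (X₂.presheaf.stalk x) (List.ofFn s)) ∧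
      ∀ x : X₂, ¬ IsClosed ({x} : Set X₂) → ∀ d : ℕ, ringKrullDim (X₂.presheaf.stalk x) = d →
        ∀ s : Fin d → X₂.presheaf.stalk x, (Ideal.span (Set.range s)).radical.IsMaximal →
          ∀ y : X₂.presheaf.stalk x, (∃ e : ℕ, y ^ p ^ e ∈
            Ideal.span ((fun z : X₂.presheaf.stalk x => z ^ p ^ e) ''
              (Ideal.span (Set.range s) : Set (X₂.presheaf.stalk x)))) → y ∈ Ideal.span (Set.range s) := by
  sorry

/-- COUNT (folklore): in a quasi-compact scheme locally of finite type over a field, a closed subset all of whose points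
are closed points is finite — the scheme is Noetherian, the closed set has finitely many irreducible components, and the
generic point of each component (schemes are sober) is a closed point, so each component is a singleton.
[cite: StacksProject, Tag 0052] -/
theorem stub_closedPointsOfClosedFinite : ∀ (k : Type) [Field k] (X₂ : Scheme.{0}) (f₂ : X₂ ⟶ Spec (.of k)),
    LocallyOfFiniteType f₂ → QuasiCompact f₂ → ∀ Z : Set X₂, IsClosed Z →
      (∀ x ∈ Z, IsClosed ({x} : Set X₂)) → Z.Finite := by
  sorry

/-- **ISO from its stubs** (kernel-checked): Macaulayfy (`stub_kawasakiIntegral`), F-injectivize generically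
(`stub_genericFInjectivization`), compose; the bad set of the top model is closed (`stub_fiLocusOpen`) and consists of
closed points, hence is finite (`stub_closedPointsOfClosedFinite`). Conclusion = piece `FInjectiveIsolation` verbatim. [folklore] -/
theorem fInjectiveIsolation_of_stubs
    (hK : ∀ (k : Type) [Field k] (X : Scheme.{0}) (f : X ⟶ Spec (.of k)),
      IsSeparated f → LocallyOfFiniteType f → QuasiCompact f → IsIntegral X →
        ∃ (X₁ : Scheme.{0}) (π₁ : X₁ ⟶ X), IsProper π₁ ∧
          Literature.AlgebraicGeometry.Resolution.IsBirational π₁ ∧ IsIntegral X₁ ∧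
          ∀ x : X₁, ∀ d : ℕ, ringKrullDim (X₁.presheaf.stalk x) = d →
            ∀ s : Fin d → X₁.presheaf.stalk x, (Ideal.span (Set.range s)).radical.IsMaximal →
              RingTheory.Sequence.IsWeaklyRegular (X₁.presheaf.stalk x) (List.ofFn s))
    (hOpen : ∀ (p : ℕ), p.Prime → ∀ (k : Type) [Field k] [CharP k p] (X₁ : Scheme.{0})
      (f₁ : X₁ ⟶ Spec (.of k)), LocallyOfFiniteType f₁ →
      (∀ x : X₁, ∀ d : ℕ, ringKrullDim (X₁.presheaf.stalk x) = d →
        ∀ s : Fin d → X₁.presheaf.stalk x, (Ideal.span (Set.range s)).radical.IsMaximal →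
          RingTheory.Sequence.IsWeaklyRegular (X₁.presheaf.stalk x) (List.ofFn s)) →
      IsOpen {x : X₁ | ∀ d : ℕ, ringKrullDim (X₁.presheaf.stalk x) = d →
        ∀ s : Fin d → X₁.presheaf.stalk x, (Ideal.span (Set.range s)).radical.IsMaximal →
          ∀ y : X₁.presheaf.stalk x, (∃ e : ℕ, y ^ p ^ e ∈
            Ideal.span ((fun z : X₁.presheaf.stalk x => z ^ p ^ e) ''
              (Ideal.span (Set.range s) : Set (X₁.presheaf.stalk x)))) → y ∈ Ideal.span (Set.range s)})
    (hGen : ∀ (p : ℕ), p.Prime → ∀ (k : Type) [Field k] [CharP k p] (X₁ : Scheme.{0})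
      (f₁ : X₁ ⟶ Spec (.of k)), IsSeparated f₁ → LocallyOfFiniteType f₁ → QuasiCompact f₁ → IsIntegral X₁ →
      (∀ x : X₁, ∀ d : ℕ, ringKrullDim (X₁.presheaf.stalk x) = d →
        ∀ s : Fin d → X₁.presheaf.stalk x, (Ideal.span (Set.range s)).radical.IsMaximal →
          RingTheory.Sequence.IsWeaklyRegular (X₁.presheaf.stalk x) (List.ofFn s)) →
      ∃ (X₂ : Scheme.{0}) (π : X₂ ⟶ X₁), IsProper π ∧ Literature.AlgebraicGeometry.Resolution.IsBirational π ∧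
        IsIntegral X₂ ∧
        (∀ x : X₂, ∀ d : ℕ, ringKrullDim (X₂.presheaf.stalk x) = d →
          ∀ s : Fin d → X₂.presheaf.stalk x, (Ideal.span (Set.range s)).radical.IsMaximal →
            RingTheory.Sequence.IsWeaklyRegular (X₂.presheaf.stalk x) (List.ofFn s)) ∧
        ∀ x : X₂, ¬ IsClosed ({x} : Set X₂) → ∀ d : ℕ, ringKrullDim (X₂.presheaf.stalk x) = d →
          ∀ s : Fin d → X₂.presheaf.stalk x, (Ideal.span (Set.range s)).radical.IsMaximal →
            ∀ y : X₂.presheaf.stalk x, (∃ e : ℕ, y ^ p ^ e ∈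
              Ideal.span ((fun z : X₂.presheaf.stalk x => z ^ p ^ e) ''
                (Ideal.span (Set.range s) : Set (X₂.presheaf.stalk x)))) → y ∈ Ideal.span (Set.range s))
    (hFin : ∀ (k : Type) [Field k] (X₂ : Scheme.{0}) (f₂ : X₂ ⟶ Spec (.of k)),
      LocallyOfFiniteType f₂ → QuasiCompact f₂ → ∀ Z : Set X₂, IsClosed Z →
        (∀ x ∈ Z, IsClosed ({x} : Set X₂)) → Z.Finite) :
    ∀ p : ℕ, p.Prime → ∀ (k : Type) [Field k] [CharP k p] (X : AlgebraicGeometry.Scheme.{0}) (f : X ⟶ AlgebraicGeometry.Spec (.of k)), AlgebraicGeometry.IsSeparated f → AlgebraicGeometry.LocallyOfFiniteType f → AlgebraicGeometry.QuasiCompact f → AlgebraicGeometry.IsIntegral X → ∃ (X₁ : AlgebraicGeometry.Scheme.{0}) (π : X₁ ⟶ X), AlgebraicGeometry.IsProper π ∧ Literature.AlgebraicGeometry.Resolution.IsBirational π ∧ AlgebraicGeometry.IsIntegral X₁ ∧ (∀ x : X₁, ∀ d : ℕ, ringKrullDim (X₁.presheaf.stalk x) = d → ∀ s : Fin d → X₁.presheaf.stalk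 x, (Ideal.span (Set.range s)).radical.IsMaximal → RingTheory.Sequence.IsWeaklyRegular (X₁.presheaf.stalk x) (List.ofFn s)) ∧ Set.Finite {x : X₁ | ¬ ∀ d : ℕ, ringKrullDim (X₁.presheaf.stalk x) = d → ∀ s : Fin d → X₁.presheaf.stalk x, (Ideal.span (Set.range s)).radical.IsMaximal → ∀ y : X₁.presheaf.stalk x, (∃ e : ℕ, y ^ p ^ e ∈ Ideal.span ((fun z : X₁.presheaf.stalk x => z ^ p ^ e) '' (Ideal.span (Set.range s) : Set (X₁.presheaf.stalk x)))) → y ∈ Ideal.span (Set.range s)} := by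
  intro p hp k _ _ X f hsep hft hqc hint
  obtain ⟨X₁, π₁, hπ₁, hbir₁, hint₁, hCM₁⟩ := hK k X f hsep hft hqc hint
  haveI := hπ₁
  haveI := hsep
  haveI := hft
  haveI := hqc
  have hsep₁ : IsSeparated (π₁ ≫ f) := inferInstance
  have hft₁ : LocallyOfFiniteType (π₁ ≫ f) := inferInstance
  have hqc₁ : QuasiCompact (π₁ ≫ f) := inferInstance
  obtain ⟨X₂, π₂, hπ₂, hbir₂, hint₂, hCM₂, hgen⟩ := hGen p hp k X₁ (π₁ ≫ f) hsep₁ hft₁ hqc₁ hint₁ hCM₁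
  haveI := hπ₂
  have hft₂ : LocallyOfFiniteType ((π₂ ≫ π₁) ≫ f) := inferInstance
  have hqc₂ : QuasiCompact ((π₂ ≫ π₁) ≫ f) := inferInstance
  refine ⟨X₂, π₂ ≫ π₁, inferInstance, ComponentGluing.IsBirational.comp hbir₂ hbir₁, hint₂, hCM₂, ?_⟩
  have hopen := hOpen p hp k X₂ ((π₂ ≫ π₁) ≫ f) hft₂ hCM₂
  refine hFin k X₂ ((π₂ ≫ π₁) ≫ f) hft₂ hqc₂ _ ?_ ?_
  · rw [← Set.compl_setOf]
    exact hopen.isClosed_compl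
  · intro x hx
    by_contra hcl
    exact hx (hgen x hcl)


/-! ## §2 Piece PT — isolated bad points, surgery by point-supported centres (3 stubs + composition) -/

/-- BAD POINTS ARE CLOSED: on a quasi-compact scheme locally of finite type over a field of characteristic `p` with
Cohen–Macaulay local rings, if only finitely many points carry a non-Frobenius-closed parameter ideal then each of them is
a closed point — the clause passes to generizations (E5: `ClauseLocalizes.fiClause_localization`,
`ClauseLocalizesScheme.fiClause_of_specializes`, landed), so every specialization of a bad point is bad, and a non-closed
point of a finite-type `k`-scheme has infinitely many specializations (its closure is a positive-dimensional Jacobson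
scheme). [folklore] -/
theorem stub_badPointsClosed : ∀ (p : ℕ), p.Prime → ∀ (k : Type) [Field k] [CharP k p] (X₁ : Scheme.{0}) (f₁ : X₁ ⟶ Spec (.of k)),
    LocallyOfFiniteType f₁ → QuasiCompact f₁ →
    (∀ x : X₁, ∀ d : ℕ, ringKrullDim (X₁.presheaf.stalk x) = d → ∀ s : Fin d → X₁.presheaf.stalk x, (Ideal.span (Set.range s)).radical.IsMaximal → RingTheory.Sequence.IsWeaklyRegular (X₁.presheaf.stalk x) (List.ofFn s)) →
    Set.Finite {x : X₁ | ¬ ∀ d : ℕ, ringKrullDim (X₁.presheaf.stalk x) = d → ∀ s : Fin d → X₁.presheaf.stalk x, (Ideal.span (Set.range s)).radical.IsMaximal → ∀ y : X₁.presheaf.stalk x, (∃ e : ℕ, y ^ p ^ e ∈ Ideal.span ((fun z : X₁.presheaf.stalk x => z ^ p ^ e) '' (Ideal.span (Set.range s) : Set (X₁.presheaf.stalk x)))) → y ∈ Ideal.span (Set.range s)} →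
    ∀ b : X₁, (¬ ∀ d : ℕ, ringKrullDim (X₁.presheaf.stalk b) = d → ∀ s : Fin d → X₁.presheaf.stalk b, (Ideal.span (Set.range s)).radical.IsMaximal → ∀ y : X₁.presheaf.stalk b, (∃ e : ℕ, y ^ p ^ e ∈ Ideal.span ((fun z : X₁.presheaf.stalk b => z ^ p ^ e) '' (Ideal.span (Set.range s) : Set (X₁.presheaf.stalk b)))) → y ∈ Ideal.span (Set.range s)) → IsClosed ({b} : Set X₁) := by
  sorry

/-- **THE OPEN LOCAL CORE — A POINT-SUPPORTED CENTRE EXISTS**: `X₁/k` integral separated of finite type, `char k = p`,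
all local rings Cohen–Macaulay, finitely many bad points; `b` a bad closed point. Then some non-zero ideal sheaf `J`
with support exactly `{b}` has a blow-up satisfying the full crux clause (domain; every s.o.p. weakly regular; every
parameter ideal Frobenius closed) at EVERY point over `b`. (One centre = one tower: composites of blow-ups in
`b`-cosupported centres are blow-ups of one such centre, Stacks 080A/080B. Instances landed: `J = 𝔪_b` for `E₈⁰` in
characteristic 5, `E8Char5FiModel`; a two-step tower for `E₈⁰` in characteristic 3, `E7Char3FiModel` after
`E8Char3NotFiModel`; never a parameter ideal, Negative `ParameterBlowupChart`.) [conjecture] -/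
theorem stub_pointCentreExists : ∀ (p : ℕ), p.Prime → ∀ (k : Type) [Field k] [CharP k p] (X₁ : Scheme.{0}) (f₁ : X₁ ⟶ Spec (.of k)),
    IsSeparated f₁ → LocallyOfFiniteType f₁ → QuasiCompact f₁ → IsIntegral X₁ →
    (∀ x : X₁, ∀ d : ℕ, ringKrullDim (X₁.presheaf.stalk x) = d → ∀ s : Fin d → X₁.presheaf.stalk x, (Ideal.span (Set.range s)).radical.IsMaximal → RingTheory.Sequence.IsWeaklyRegular (X₁.presheaf.stalk x) (List.ofFn s)) →
    Set.Finite {x : X₁ | ¬ ∀ d : ℕ, ringKrullDim (X₁.presheaf.stalk x) = d → ∀ s : Fin d → X₁.presheaf.stalk x, (Ideal.span (Set.range s)).radical.IsMaximal → ∀ y : X₁.presheaf.stalk x, (∃ e : ℕ, y ^ p ^ e ∈ Ideal.span ((fun z : X₁.presheaf.stalk x => z ^ p ^ e) '' (Ideal.span (Set.range s) : Set (X₁.presheaf.stalk x)))) → y ∈ Ideal.span (Set.range s)} →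
    ∀ b : X₁, IsClosed ({b} : Set X₁) → (¬ ∀ d : ℕ, ringKrullDim (X₁.presheaf.stalk b) = d → ∀ s : Fin d → X₁.presheaf.stalk b, (Ideal.span (Set.range s)).radical.IsMaximal → ∀ y : X₁.presheaf.stalk b, (∃ e : ℕ, y ^ p ^ e ∈ Ideal.span ((fun z : X₁.presheaf.stalk b => z ^ p ^ e) '' (Ideal.span (Set.range s) : Set (X₁.presheaf.stalk b)))) → y ∈ Ideal.span (Set.range s)) →
    ∃ J : X₁.IdealSheafData, J ≠ ⊥ ∧ (J.support : Set X₁) = {b} ∧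
      ∀ (X' : Scheme.{0}) (π : X' ⟶ X₁), Literature.AlgebraicGeometry.Resolution.IsBlowup π J →
        ∀ x' : X', π.base x' = b → IsDomain (X'.presheaf.stalk x') ∧ ∀ d : ℕ, ringKrullDim (X'.presheaf.stalk x') = d → ∀ s : Fin d → X'.presheaf.stalk x', (Ideal.span (Set.range s)).radical.IsMaximal → RingTheory.Sequence.IsWeaklyRegular (X'.presheaf.stalk x') (List.ofFn s) ∧ ∀ y : X'.presheaf.stalk x', (∃ e : ℕ, y ^ p ^ e ∈ Ideal.span ((fun z : X'.presheaf.stalk x' => z ^ p ^ e) '' (Ideal.span (Set.range s) : Set (X'.presheaf.stalk x')))) → y ∈ Ideal.span (Set.range s) := by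
  sorry

/-- SURGERY GLUE (folklore): `X₁/k` integral separated of finite type, `char k = p`, Cohen–Macaulay local rings; `T` a
finite set of closed points containing every bad point; for each `b ∈ T` a non-zero ideal sheaf `J b` supported exactly
at `b` all of whose blow-ups satisfy the full clause over `b`. Then `X₁` has a proper birational model with the full
clause at every stalk: the blow-up `π` of `⨅_{b ∈ T} J b` (`exists_isBlowup`) is proper (`IsBlowup.isProper`),
birational (`IsBlowup.isBirational'`, the centre is non-zero on the integral `X₁`), an isomorphism over `X₁ ∖ T`
(`IsBlowup.isIso_compl`; there the stalks are those of `X₁`: domains, Cohen–Macaulay, all parameter ideals Frobenius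
closed — transport by `Reductions.fiClause_of_ringEquiv`), and over the open neighbourhood `X₁ ∖ (T ∖ {b})` of `b` it
is a blow-up of `J b` (`IsBlowup.restrict` + `IsBlowup.unique`), whence the clause over `b`. [folklore] -/
theorem stub_surgeryGlue : ∀ (p : ℕ), p.Prime → ∀ (k : Type) [Field k] [CharP k p] (X₁ : Scheme.{0}) (f₁ : X₁ ⟶ Spec (.of k)),
    IsSeparated f₁ → LocallyOfFiniteType f₁ → QuasiCompact f₁ → IsIntegral X₁ →
    (∀ x : X₁, ∀ d : ℕ, ringKrullDim (X₁.presheaf.stalk x) = d → ∀ s : Fin d → X₁.presheaf.stalk x, (Ideal.span (Set.range s)).radical.IsMaximal → RingTheory.Sequence.IsWeaklyRegular (X₁.presheaf.stalk x) (List.ofFn s)) →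
    ∀ (T : Set X₁), T.Finite → (∀ b ∈ T, IsClosed ({b} : Set X₁)) →
    (∀ x : X₁, (¬ ∀ d : ℕ, ringKrullDim (X₁.presheaf.stalk x) = d → ∀ s : Fin d → X₁.presheaf.stalk x, (Ideal.span (Set.range s)).radical.IsMaximal → ∀ y : X₁.presheaf.stalk x, (∃ e : ℕ, y ^ p ^ e ∈ Ideal.span ((fun z : X₁.presheaf.stalk x => z ^ p ^ e) '' (Ideal.span (Set.range s) : Set (X₁.presheaf.stalk x)))) → y ∈ Ideal.span (Set.range s)) → x ∈ T) →
    ∀ (J : X₁ → X₁.IdealSheafData),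
    (∀ b ∈ T, J b ≠ ⊥ ∧ ((J b).support : Set X₁) = {b} ∧
      ∀ (X' : Scheme.{0}) (π : X' ⟶ X₁), Literature.AlgebraicGeometry.Resolution.IsBlowup π (J b) →
        ∀ x' : X', π.base x' = b → IsDomain (X'.presheaf.stalk x') ∧ ∀ d : ℕ, ringKrullDim (X'.presheaf.stalk x') = d → ∀ s : Fin d → X'.presheaf.stalk x', (Ideal.span (Set.range s)).radical.IsMaximal → RingTheory.Sequence.IsWeaklyRegular (X'.presheaf.stalk x') (List.ofFn s) ∧ ∀ y : X'.presheaf.stalk x', (∃ e : ℕ, y ^ p ^ e ∈ Ideal.span ((fun z : X'.presheaf.stalk x' => z ^ p ^ e) '' (Ideal.span (Set.range s) : Set (X'.presheaf.stalk x')))) → y ∈ Ideal.span (Set.range s)) →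
    ∃ (X' : Scheme.{0}) (π : X' ⟶ X₁), IsProper π ∧ Literature.AlgebraicGeometry.Resolution.IsBirational π ∧
      ∀ x : X', IsDomain (X'.presheaf.stalk x) ∧ ∀ d : ℕ, ringKrullDim (X'.presheaf.stalk x) = d → ∀ s : Fin d → X'.presheaf.stalk x, (Ideal.span (Set.range s)).radical.IsMaximal → RingTheory.Sequence.IsWeaklyRegular (X'.presheaf.stalk x) (List.ofFn s) ∧ ∀ y : X'.presheaf.stalk x, (∃ e : ℕ, y ^ p ^ e ∈ Ideal.span ((fun z : X'.presheaf.stalk x => z ^ p ^ e) '' (Ideal.span (Set.range s) : Set (X'.presheaf.stalk x)))) → y ∈ Ideal.span (Set.range s) := by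
  sorry

/-- **PT from its stubs** (kernel-checked): the bad set is finite (hypothesis) and consists of closed points
(`stub_badPointsClosed`); choose a point-supported good centre at each bad point (`stub_pointCentreExists`, classical choice);
glue (`stub_surgeryGlue`). Conclusion = piece `IsolatedFInjectivization` verbatim. [folklore] -/
theorem isolatedFInjectivization_of_stubs
    (hClosed : ∀ (p : ℕ), p.Prime → ∀ (k : Type) [Field k] [CharP k p] (X₁ : Scheme.{0}) (f₁ : X₁ ⟶ Spec (.of k)),
    LocallyOfFiniteType f₁ → QuasiCompact f₁ →
    (∀ x : X₁, ∀ d : ℕ, ringKrullDim (X₁.presheaf.stalk x) = d → ∀ s : Fin d → X₁.presheaf.stalk x, (Ideal.span (Set.range s)).radical.IsMaximal → RingTheory.Sequence.IsWeaklyRegular (X₁.presheaf.stalk x) (List.ofFn s)) →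
    Set.Finite {x : X₁ | ¬ ∀ d : ℕ, ringKrullDim (X₁.presheaf.stalk x) = d → ∀ s : Fin d → X₁.presheaf.stalk x, (Ideal.span (Set.range s)).radical.IsMaximal → ∀ y : X₁.presheaf.stalk x, (∃ e : ℕ, y ^ p ^ e ∈ Ideal.span ((fun z : X₁.presheaf.stalk x => z ^ p ^ e) '' (Ideal.span (Set.range s) : Set (X₁.presheaf.stalk x)))) → y ∈ Ideal.span (Set.range s)} →
    ∀ b : X₁, (¬ ∀ d : ℕ, ringKrullDim (X₁.presheaf.stalk b) = d → ∀ s : Fin d → X₁.presheaf.stalk b, (Ideal.span (Set.range s)).radical.IsMaximal → ∀ y : X₁.presheaf.stalk b, (∃ e : ℕ, y ^ p ^ e ∈ Ideal.span ((fun z : X₁.presheaf.stalk b => z ^ p ^ e) '' (Ideal.span (Set.range s) : Set (X₁.presheaf.stalk b)))) → y ∈ Ideal.span (Set.range s)) → IsClosed ({b} : Set X₁))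
    (hLocal : ∀ (p : ℕ), p.Prime → ∀ (k : Type) [Field k] [CharP k p] (X₁ : Scheme.{0}) (f₁ : X₁ ⟶ Spec (.of k)),
    IsSeparated f₁ → LocallyOfFiniteType f₁ → QuasiCompact f₁ → IsIntegral X₁ →
    (∀ x : X₁, ∀ d : ℕ, ringKrullDim (X₁.presheaf.stalk x) = d → ∀ s : Fin d → X₁.presheaf.stalk x, (Ideal.span (Set.range s)).radical.IsMaximal → RingTheory.Sequence.IsWeaklyRegular (X₁.presheaf.stalk x) (List.ofFn s)) →
    Set.Finite {x : X₁ | ¬ ∀ d : ℕ, ringKrullDim (X₁.presheaf.stalk x) = d → ∀ s : Fin d → X₁.presheaf.stalk x, (Ideal.span (Set.range s)).radical.IsMaximal → ∀ y : X₁.presheaf.stalk x, (∃ e : ℕ, y ^ p ^ e ∈ Ideal.span ((fun z : X₁.presheaf.stalk x => z ^ p ^ e) '' (Ideal.span (Set.range s) : Set (X₁.presheaf.stalk x)))) → y ∈ Ideal.span (Set.range s)} →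
    ∀ b : X₁, IsClosed ({b} : Set X₁) → (¬ ∀ d : ℕ, ringKrullDim (X₁.presheaf.stalk b) = d → ∀ s : Fin d → X₁.presheaf.stalk b, (Ideal.span (Set.range s)).radical.IsMaximal → ∀ y : X₁.presheaf.stalk b, (∃ e : ℕ, y ^ p ^ e ∈ Ideal.span ((fun z : X₁.presheaf.stalk b => z ^ p ^ e) '' (Ideal.span (Set.range s) : Set (X₁.presheaf.stalk b)))) → y ∈ Ideal.span (Set.range s)) →
    ∃ J : X₁.IdealSheafData, J ≠ ⊥ ∧ (J.support : Set X₁) = {b} ∧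
      ∀ (X' : Scheme.{0}) (π : X' ⟶ X₁), Literature.AlgebraicGeometry.Resolution.IsBlowup π J →
        ∀ x' : X', π.base x' = b → IsDomain (X'.presheaf.stalk x') ∧ ∀ d : ℕ, ringKrullDim (X'.presheaf.stalk x') = d → ∀ s : Fin d → X'.presheaf.stalk x', (Ideal.span (Set.range s)).radical.IsMaximal → RingTheory.Sequence.IsWeaklyRegular (X'.presheaf.stalk x') (List.ofFn s) ∧ ∀ y : X'.presheaf.stalk x', (∃ e : ℕ, y ^ p ^ e ∈ Ideal.span ((fun z : X'.presheaf.stalk x' => z ^ p ^ e) '' (Ideal.span (Set.range s) : Set (X'.presheaf.stalk x')))) → y ∈ Ideal.span (Set.range s))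
    (hGlue : ∀ (p : ℕ), p.Prime → ∀ (k : Type) [Field k] [CharP k p] (X₁ : Scheme.{0}) (f₁ : X₁ ⟶ Spec (.of k)),
    IsSeparated f₁ → LocallyOfFiniteType f₁ → QuasiCompact f₁ → IsIntegral X₁ →
    (∀ x : X₁, ∀ d : ℕ, ringKrullDim (X₁.presheaf.stalk x) = d → ∀ s : Fin d → X₁.presheaf.stalk x, (Ideal.span (Set.range s)).radical.IsMaximal → RingTheory.Sequence.IsWeaklyRegular (X₁.presheaf.stalk x) (List.ofFn s)) →
    ∀ (T : Set X₁), T.Finite → (∀ b ∈ T, IsClosed ({b} : Set X₁)) →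
    (∀ x : X₁, (¬ ∀ d : ℕ, ringKrullDim (X₁.presheaf.stalk x) = d → ∀ s : Fin d → X₁.presheaf.stalk x, (Ideal.span (Set.range s)).radical.IsMaximal → ∀ y : X₁.presheaf.stalk x, (∃ e : ℕ, y ^ p ^ e ∈ Ideal.span ((fun z : X₁.presheaf.stalk x => z ^ p ^ e) '' (Ideal.span (Set.range s) : Set (X₁.presheaf.stalk x)))) → y ∈ Ideal.span (Set.range s)) → x ∈ T) →
    ∀ (J : X₁ → X₁.IdealSheafData),
    (∀ b ∈ T, J b ≠ ⊥ ∧ ((J b).support : Set X₁) = {b} ∧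
      ∀ (X' : Scheme.{0}) (π : X' ⟶ X₁), Literature.AlgebraicGeometry.Resolution.IsBlowup π (J b) →
        ∀ x' : X', π.base x' = b → IsDomain (X'.presheaf.stalk x') ∧ ∀ d : ℕ, ringKrullDim (X'.presheaf.stalk x') = d → ∀ s : Fin d → X'.presheaf.stalk x', (Ideal.span (Set.range s)).radical.IsMaximal → RingTheory.Sequence.IsWeaklyRegular (X'.presheaf.stalk x') (List.ofFn s) ∧ ∀ y : X'.presheaf.stalk x', (∃ e : ℕ, y ^ p ^ e ∈ Ideal.span ((fun z : X'.presheaf.stalk x' => z ^ p ^ e) '' (Ideal.span (Set.range s) : Set (X'.presheaf.stalk x')))) → y ∈ Ideal.span (Set.range s)) →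
    ∃ (X' : Scheme.{0}) (π : X' ⟶ X₁), IsProper π ∧ Literature.AlgebraicGeometry.Resolution.IsBirational π ∧
      ∀ x : X', IsDomain (X'.presheaf.stalk x) ∧ ∀ d : ℕ, ringKrullDim (X'.presheaf.stalk x) = d → ∀ s : Fin d → X'.presheaf.stalk x, (Ideal.span (Set.range s)).radical.IsMaximal → RingTheory.Sequence.IsWeaklyRegular (X'.presheaf.stalk x) (List.ofFn s) ∧ ∀ y : X'.presheaf.stalk x, (∃ e : ℕ, y ^ p ^ e ∈ Ideal.span ((fun z : X'.presheaf.stalk x => z ^ p ^ e) '' (Ideal.span (Set.range s) : Set (X'.presheaf.stalk x)))) → y ∈ Ideal.span (Set.range s)) :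
    ∀ p : ℕ, p.Prime → ∀ (k : Type) [Field k] [CharP k p] (X₁ : AlgebraicGeometry.Scheme.{0}) (f₁ : X₁ ⟶ AlgebraicGeometry.Spec (.of k)), AlgebraicGeometry.IsSeparated f₁ → AlgebraicGeometry.LocallyOfFiniteType f₁ → AlgebraicGeometry.QuasiCompact f₁ → AlgebraicGeometry.IsIntegral X₁ → (∀ x : X₁, ∀ d : ℕ, ringKrullDim (X₁.presheaf.stalk x) = d → ∀ s : Fin d → X₁.presheaf.stalk x, (Ideal.span (Set.range s)).radical.IsMaximal → RingTheory.Sequence.IsWeaklyRegular (X₁.presheaf.stalk x) (List.ofFn s)) → Set.Finite {x : X₁ | ¬ ∀ d : ℕ, ringKrullDim (X₁.presheaf.stalk x) = d → ∀ s : Fin d → X₁.presheaf.stalk x, (Ideal.span (Set.range s)).radical.IsMaximal → ∀ y : X₁.presheaf.stalk x, (∃ e : ℕ, y ^ p ^ e ∈ Ideal.span ((fun z : X₁.presheaf.stalk x => z ^ p ^ e) '' (Ideal.span (Set.range s) : Set (X₁.presheaf.stalk x)))) → y ∈ Ideal.span (Set.range s)} → ∃ (X' : AlgebraicGeometry.Scheme.{0})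 (π : X' ⟶ X₁), AlgebraicGeometry.IsProper π ∧ Literature.AlgebraicGeometry.Resolution.IsBirational π ∧ ∀ x : X', IsDomain (X'.presheaf.stalk x) ∧ ∀ d : ℕ, ringKrullDim (X'.presheaf.stalk x) = d → ∀ s : Fin d → X'.presheaf.stalk x, (Ideal.span (Set.range s)).radical.IsMaximal → RingTheory.Sequence.IsWeaklyRegular (X'.presheaf.stalk x) (List.ofFn s) ∧ ∀ y : X'.presheaf.stalk x, (∃ e : ℕ, y ^ p ^ e ∈ Ideal.span ((fun z : X'.presheaf.stalk x => z ^ p ^ e) '' (Ideal.span (Set.range s) : Set (X'.presheaf.stalk x)))) → y ∈ Ideal.span (Set.range s) := by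
  intro p hp k _ _ X₁ f₁ hsep hft hqc hint hCM hfin
  classical
  have hJ : ∀ b : X₁, ∃ J : X₁.IdealSheafData,
      b ∈ {x : X₁ | ¬ ∀ d : ℕ, ringKrullDim (X₁.presheaf.stalk x) = d → ∀ s : Fin d → X₁.presheaf.stalk x, (Ideal.span (Set.range s)).radical.IsMaximal → ∀ y : X₁.presheaf.stalk x, (∃ e : ℕ, y ^ p ^ e ∈ Ideal.span ((fun z : X₁.presheaf.stalk x => z ^ p ^ e) '' (Ideal.span (Set.range s) : Set (X₁.presheaf.stalk x)))) → y ∈ Ideal.span (Set.range s)} →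
        (J ≠ ⊥ ∧ (J.support : Set X₁) = {b} ∧
          ∀ (X' : Scheme.{0}) (π : X' ⟶ X₁), Literature.AlgebraicGeometry.Resolution.IsBlowup π J →
            ∀ x' : X', π.base x' = b → IsDomain (X'.presheaf.stalk x') ∧ ∀ d : ℕ, ringKrullDim (X'.presheaf.stalk x') = d → ∀ s : Fin d → X'.presheaf.stalk x', (Ideal.span (Set.range s)).radical.IsMaximal → RingTheory.Sequence.IsWeaklyRegular (X'.presheaf.stalk x') (List.ofFn s) ∧ ∀ y : X'.presheaf.stalk x', (∃ e : ℕ, y ^ p ^ e ∈ Ideal.span ((fun z : X'.presheaf.stalk x' => z ^ p ^ e) '' (Ideal.span (Set.range s) : Set (X'.presheaf.stalk x')))) → y ∈ Ideal.span (Set.range s)) := by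
    intro b
    by_cases hb : b ∈ {x : X₁ | ¬ ∀ d : ℕ, ringKrullDim (X₁.presheaf.stalk x) = d → ∀ s : Fin d → X₁.presheaf.stalk x, (Ideal.span (Set.range s)).radical.IsMaximal → ∀ y : X₁.presheaf.stalk x, (∃ e : ℕ, y ^ p ^ e ∈ Ideal.span ((fun z : X₁.presheaf.stalk x => z ^ p ^ e) '' (Ideal.span (Set.range s) : Set (X₁.presheaf.stalk x)))) → y ∈ Ideal.span (Set.range s)}
    · obtain ⟨J, hJ⟩ := hLocal p hp k X₁ f₁ hsep hft hqc hint hCM hfin b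
        (hClosed p hp k X₁ f₁ hft hqc hCM hfin b hb) hb
      exact ⟨J, fun _ => hJ⟩
    · exact ⟨⊤, fun h => absurd h hb⟩
  choose J hJ using hJ
  exact hGlue p hp k X₁ f₁ hsep hft hqc hint hCM _ hfin
    (fun b hb => hClosed p hp k X₁ f₁ hft hqc hCM hfin b hb) (fun x hx => hx) J (fun b hb => hJ b hb)


/-! ## §3 SKELETON THEOREM (hypothesis-free; the registered composition): the seven stubs imply the crux BY NAME -/

/-- **SKELETON THEOREM** `FInjectiveMacaulayfication_proof` (kernel-checked; `sorry` only inside the seven `stub_*`): stubs §1 ⟹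
ISO (`fInjectiveIsolation_of_stubs`), stubs §2 ⟹ PT (`isolatedFInjectivization_of_stubs`), then the ASSEMBLY ISO ∧ PT ⟹ crux:
`fInjectiveMacaulayfication_iff_integral.mpr`; isolation model `π₁ : X₁ → X`; isolated F-injectivization of `X₁` over `π₁ ≫ f`;
compose (proper ∘ proper, `ComponentGluing.IsBirational.comp`, `isIntegral_of_isBirational_of_isDomain_stalk`). Concludes
`FrobeniusLadder.FInjectiveMacaulayfication` by name. [folklore] -/
theorem FInjectiveMacaulayfication_proof :
    Summit.ResolutionOfSingularities.ResolutionOfSingularities.Theses.FrobeniusLadder.FInjectiveMacaulayfication := by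
  have hI := fInjectiveIsolation_of_stubs stub_kawasakiIntegral stub_fiLocusOpen stub_genericFInjectivization
    stub_closedPointsOfClosedFinite
  have hP := isolatedFInjectivization_of_stubs stub_badPointsClosed stub_pointCentreExists stub_surgeryGlue
  refine fInjectiveMacaulayfication_iff_integral.mpr ?_
  intro p hp k _ _ X f hsep hft hqc hint
  obtain ⟨X₁, π₁, hπ₁, hbir₁, hint₁, hCM, hfin⟩ := hI p hp k X f hsep hft hqc hint
  haveI := hπ₁
  haveI := hsep
  haveI := hft
  haveI := hqc
  have hsep₁ : IsSeparated (π₁ ≫ f) := inferInstance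
  have hft₁ : LocallyOfFiniteType (π₁ ≫ f) := inferInstance
  have hqc₁ : QuasiCompact (π₁ ≫ f) := inferInstance
  obtain ⟨X', π, hπ, hbir, hgood⟩ := hP p hp k X₁ (π₁ ≫ f) hsep₁ hft₁ hqc₁ hint₁ hCM hfin
  haveI := hπ
  haveI := hint₁
  exact ⟨X', π ≫ π₁, inferInstance, ComponentGluing.IsBirational.comp hbir hbir₁,
    isIntegral_of_isBirational_of_isDomain_stalk (ComponentGluing.IsBirational.comp hbir hbir₁)
      fun x => (hgood x).1, hgood⟩

/-! ## §4 Where the stand-alone assembly lives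
The binder form `FInjectiveIsolation → IsolatedFInjectivization → FInjectiveMacaulayfication` (sorry-free, axioms
propext / Classical.choice / Quot.sound) is NOT restated here — a theorem with `Prop` hypotheses concluding the crux would be read
as the skeleton by `#h21_check_skeleton` (hypotheses must be registered obligations BY NAME). It is the crux workfile
`Cruxes/FInjectiveMacaulayfication/IsolationSplit.lean` (`Split.fInjectiveMacaulayfication_of_isolation_of_isolated`, with the
converses `isolation_of_fInjectiveMacaulayfication`, `isolated_of_fInjectiveMacaulayfication`), verbatim the candidate Theorems file
`FrobeniusLadderFInjectiveMacaulayficationSplit.lean` attached as evidence on the crux item; `FInjectiveMacaulayfication_proof` above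
inlines the same proof with the two pieces obtained from the stubs. -/

end Summit.ResolutionOfSingularities.ResolutionOfSingularities.Cruxes.FInjectiveMacaulayfication.Isolation

end
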